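import Literature.AnabelianGeometry.EtaleTheta.Discharge.Sec3Prop34CnstOfRlfRFinite
import Literature.AnabelianGeometry.EtaleTheta.TemperedFrobenioidCnst
import Literature.AnabelianGeometry.EtaleTheta.RealifiedDivisorMonoidsOfRlfR
import Literature.AnabelianGeometry.EtaleTheta.FrdIVocabulary
import Literature.AlgebraicGeometry.Frobenioids.PiMonoprimePerfFactorial
import Literature.AlgebraicGeometry.Frobenioids.FactorizationTransport
import Literature.AlgebraicGeometry.Frobenioids.PerfectionPrimes
import Literature.AlgebraicGeometry.Frobenioids.PerfectionDivisorial
import HarnessLib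

/-!
# The witness monoid `Φ₀ = ∏_{ℚ_{≥0}} ℚ_{≥0}`: its prime coordinates, and two divisors whose effective real cone is the
# irrational ray `ℝ_{≥0}·(√2, 1)` (part 1 of the counterexample `Sec3Prop34CnstOfRlfRSupportNegative.lean`)

Witness data (carries definitions) for the NEGATIVE companion of `Discharge/Sec3Prop34CnstOfRlfRSupport.lean`, cell
abc-iut, sub-DAG `plan/L2/SUBDAG-EtTh-Thm37.md`, row «EtTh:Thm3.7(iii)/L10-R», GAP-LEDGER G-w5d130-1 (objects with
infinitely many primes).  Sources: S. Mochizuki, *The geometry of Frobenioids I* [FrdI], §0 pp.10–12 (primes, `M_𝔭`,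
monoprime monoids), Def. 2.4 (i) p.47 (perf-factorial monoids, the factorization homomorphism `M^pf → ∏_𝔮 M^rlf_𝔮`)
[cite: MochizukiFrdI2008, Def. 2.4(i) p.47]; S. Mochizuki, *The étale theta function …* [EtTh], Def. 3.3 p.73,
Prop. 3.4 (ii) p.74 (PDF) [cite: MochizukiEtTh2009, Prop 3.4 (ii) p.74].

Contents: `M := ∏_{j ∈ ℚ_{≥0}} ℚ_{≥0}` is perf-factorial (`PiMonoprime.isPerfFactorial`, abc-iut-w4-d084) with every
`M^pf_𝔮` a `ℚ`-monoprime monoid (`hQ`); **its prime coordinates are the evaluations** — for every prime `𝔮'` of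
`M^pf` and every chart `f : M^rlf_𝔮' ≅ ℝ_{≥0}` there is `κ > 0` with `coord_𝔮'(ι m) = κ · m(j(𝔮'))`
(`exists_coord_eq_mul_eval`: the factorization homomorphism of a full product is `m ↦ (m|_j ⊗ 1)_𝔭`,
`PiMonoprime.fmap_apply`, transported to `M^pf` by `Factorization.fmap_congr`, and a chart restricted to
`M^pf_𝔮' ≅ ℚ_{≥0}` is a homothety, `RealificationCoord.chart_Q`).  The two divisors `u := 𝟙_{j² < 2} − 𝟙_{j² > 2}`,
`v := −j·𝟙_{j² < 2} + j·𝟙_{j² > 2}` in `M^gp` and `B₀ := ℤ² → M^gp`, `(a, b) ↦ a·u + b·v`: a REAL combination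
`a·u + b·v` is effective iff `a = √2·b`, `b ≥ 0` (`eq_sqrt_two_mul_of_forall_nonneg`, density of `ℚ` in `ℝ`), so no
non-trivial INTEGER combination is effective (`eq_one_of_c_divH_nonneg`, `√2 ∉ ℚ`).  Part 2 builds the Def. 3.3 (iii)
data and the effective non-constant element `√2 • ι(u) · ι(v)` of `ℝ·Φ₀^birat`.  HONEST FRAMING: toy data about the
cell's abstract interfaces; nothing here bears on [IUTchIII] Cor. 3.12.
-/

noncomputable section

namespace Literature.AnabelianGeometry.EtaleTheta

open CategoryTheory Opposite Literature.AlgebraicGeometry.Frobenioids NNReal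

namespace Sec3Prop34CnstOfRlfRSupportNegative

/-- `Φ₀ := ∏_{j ∈ ℚ_{≥0}} ℚ_{≥0}` (multiplicatively), a full product of perfect `ℚ`-monoprime monoids.
[cite: MochizukiFrdI2008, Def. 2.4(i) p.47] -/
abbrev M : Type := ℚ≥0 → Multiplicative ℚ≥0

/-- Each factor `ℚ_{≥0}` is (`ℚ`-)monoprime. [cite: MochizukiFrdI2008, §0 p.10] -/
theorem hP : ∀ _ : ℚ≥0, IsMonoprime (Multiplicative ℚ≥0) := fun _ => IsMonoprime.ofQ ⟨⟨MulEquiv.refl _⟩⟩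

/-- Each factor `ℚ_{≥0}` is perfect. [cite: MochizukiFrdI2008, §0 p.11] -/
theorem hperf : ∀ _ : ℚ≥0, IsPerfect (Multiplicative ℚ≥0) := fun _ => isPerfect_multiplicative_nnrat

/-- `Φ₀ = ∏_{ℚ_{≥0}} ℚ_{≥0}` is perf-factorial (a FULL product of perfect monoprime monoids, [FrdI] Def. 2.4 (i);
`PiMonoprime.isPerfFactorial`), with infinitely many primes `≅ ℚ_{≥0}` (the indices) and infinitely supported
elements. [cite: MochizukiFrdI2008, Def. 2.4(i) p.47] -/
theorem hpfM : IsPerfFactorial M := PiMonoprime.isPerfFactorial hP hperf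

/-- `M` is perfect, `e : M ≅ M^pf`. [cite: MochizukiFrdI2008, §0 p.11] -/
theorem hperfM : IsPerfect M := PiMonoprime.isPerfect hperf

/-- `M` is sharp. [cite: MochizukiFrdI2008, §0 p.11] -/
theorem hsharpM : IsSharp M := PiMonoprime.isSharp fun j => MonoprimeStructure.isSharp (hP j)

/-- The canonical `e : M ≅ M^pf` (`M` is perfect). [cite: MochizukiFrdI2008, §0 p.11] -/
abbrev eM := hperfM.equivPerfection

/-- The index `j(𝔮') ∈ ℚ_{≥0}` of a prime `𝔮'` of `M^pf ≅ M = ∏_j ℚ_{≥0}` (`Prime(∏_j P_j) ≅ {j}`).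
[cite: MochizukiFrdI2008, §0 p.12] -/
def jdx (𝔮' : Primes (Perfection M)) : ℚ≥0 := PiMonoprime.idx hP (Factorization.pre eM 𝔮')

/-- Every prime of `M` is `ℚ`-monoprime (`M_𝔭 ≅ ℚ_{≥0}`, the `idx 𝔭`-th factor). [cite: MochizukiFrdI2008, §0 p.12] -/
theorem hZQ (𝔭 : Primes M) : IsZMonoprime ↥𝔭.submonoid ∨ IsQMonoprime ↥𝔭.submonoid :=
  Or.inr ⟨⟨PiMonoprime.submonoidEquiv hP 𝔭 (PiMonoprime.idx hP 𝔭) (PiMonoprime.primeOf_idx hP 𝔭)⟩⟩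

/-- **Every `M^pf_𝔮'` is `ℚ`-monoprime** — the hypothesis `hQ` of `eff_of_finite_ratPrimes` holds for `Φ₀`.
[cite: MochizukiFrdI2008, Def. 2.4(i) p.47] -/
theorem hQ (𝔮' : Primes (Perfection M)) : IsQMonoprime (PfAt M 𝔮') :=
  RealifiedDivisorMonoids.Prop34Cnst.isQMonoprime_pfAt_of_forall hsharpM hZQ 𝔮'

/-- The chart `M^pf_𝔮' ≅ M_𝔮 ≅ ℚ_{≥0}` (`𝔮 = e⁻¹ 𝔮'`, evaluation at `idx 𝔮`). [cite: MochizukiFrdI2008, §0 p.12] -/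
def e0 (𝔮' : Primes (Perfection M)) : Factorization.PAt (Perfection M) 𝔮' ≃* Multiplicative ℚ≥0 :=
  (Factorization.subEquiv eM (Factorization.pre eM 𝔮') 𝔮' (Factorization.congr_pre eM 𝔮')).symm.trans
    (PiMonoprime.submonoidEquiv hP (Factorization.pre eM 𝔮') (PiMonoprime.idx hP (Factorization.pre eM 𝔮'))
      (PiMonoprime.primeOf_idx hP (Factorization.pre eM 𝔮')))

/-- `e0` on the transported restriction `e(m|_j)` is `m(j)`. [cite: MochizukiFrdI2008, §0 p.12] -/
theorem e0_subEquiv_res (𝔮' : Primes (Perfection M)) (m : M) :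
    e0 𝔮' (Factorization.subEquiv eM (Factorization.pre eM 𝔮') 𝔮' (Factorization.congr_pre eM 𝔮')
      (PiMonoprime.res hP (Factorization.pre eM 𝔮') m)) = m (jdx 𝔮') := by
  show PiMonoprime.submonoidEquiv hP _ _ (PiMonoprime.primeOf_idx hP (Factorization.pre eM 𝔮'))
    ((Factorization.subEquiv eM (Factorization.pre eM 𝔮') 𝔮' (Factorization.congr_pre eM 𝔮')).symm
      (Factorization.subEquiv eM (Factorization.pre eM 𝔮') 𝔮' (Factorization.congr_pre eM 𝔮')
        (PiMonoprime.res hP (Factorization.pre eM 𝔮') m))) = _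
  rw [MulEquiv.symm_apply_apply]
  show (PiMonoprime.res hP (Factorization.pre eM 𝔮') m : M) (PiMonoprime.idx hP (Factorization.pre eM 𝔮')) = _
  rw [PiMonoprime.coe_res, Pi.mulSingle_eq_same]
  rfl

/-- The `𝔮'`-component of the factorization homomorphism at `ι(m)`, `m ∈ M`: the transported restriction
`e(m|_j) ⊗ 1` (`PiMonoprime.fmap_apply` + `Factorization.fmap_congr`). [cite: MochizukiFrdI2008, Def. 2.4(i) p.47] -/
theorem coe_toRealification_apply (𝔮' : Primes (Perfection M)) (m : M) :
    ((hpfM.toRealification (Perfection.of M m) : hpfM.Rlf) : RlfFactor M) 𝔮' =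
      Realification.of _ (Factorization.subEquiv eM (Factorization.pre eM 𝔮') 𝔮' (Factorization.congr_pre eM 𝔮')
        (PiMonoprime.res hP (Factorization.pre eM 𝔮') m)) := by
  classical
  have hc := congrFun (Factorization.fmap_congr eM m) 𝔮'
  exact hc.trans ((congrArg (Factorization.rlfEquiv eM (Factorization.pre eM 𝔮') 𝔮' (Factorization.congr_pre eM 𝔮'))
    (PiMonoprime.fmap_apply hP m _)).trans (Realification.congr_of _ _))

/-- **The prime coordinates of `Φ₀ = ∏_j ℚ_{≥0}` are the evaluations**: for every prime `𝔮'` of `M^pf` and every chart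
`f : M^rlf_𝔮' ≅ ℝ_{≥0}` there is `κ > 0` with `coord_𝔮'(ι m) = κ · m(j(𝔮'))` for all `m ∈ M` (a chart restricted to
`M^pf_𝔮' ≅ ℚ_{≥0}` is a homothety, `RealificationCoord.chart_Q`). [cite: MochizukiFrdI2008, Def. 2.4(i) p.47] -/
theorem exists_coord_eq_mul_eval (𝔮' : Primes (Perfection M)) (f : RlfAt M 𝔮' ≃* Multiplicative ℝ≥0) :
    ∃ κ : ℝ≥0, κ ≠ 0 ∧ ∀ m : M,
      Multiplicative.toAdd (PrimeCoord.coord hpfM 𝔮' f (hpfM.toRealification (Perfection.of M m))) =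
        κ * ((Multiplicative.toAdd (m (jdx 𝔮')) : ℚ≥0) : ℝ≥0) := by
  obtain ⟨κ, hκ, hchart⟩ := RealificationCoord.chart_Q f (e0 𝔮')
  refine ⟨κ, hκ, fun m => ?_⟩
  rw [PrimeCoord.coord_apply, coe_toRealification_apply, hchart, e0_subEquiv_res]

/-- The index of the transported prime `e(𝔭_j)` is `j`. [cite: MochizukiFrdI2008, §0 p.12] -/
theorem jdx_congr_primeOf (j : ℚ≥0) : jdx (Primes.congr eM (PiMonoprime.primeOf hP j)) = j :=
  (congrArg (PiMonoprime.idx hP) (Factorization.pre_congr eM _)).trans (PiMonoprime.idx_primeOf hP j)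

/-! ### The two rational functions: `u = 𝟙_{j²<2} − 𝟙_{j²>2}`, `v = −j·𝟙_{j²<2} + j·𝟙_{j²>2}` (additive coordinates) -/

/-- `u⁺ := 𝟙_{j² < 2}` (value `1` at the indices `j < √2`). [cite: MochizukiEtTh2009, Def 3.3 p.73] -/
def uP : M := fun j => if j * j < 2 then Multiplicative.ofAdd 1 else 1
/-- `u⁻ := 𝟙_{j² > 2}`. [cite: MochizukiEtTh2009, Def 3.3 p.73] -/
def uN : M := fun j => if j * j < 2 then 1 else Multiplicative.ofAdd 1
/-- `v⁺ := j · 𝟙_{j² > 2}`. [cite: MochizukiEtTh2009, Def 3.3 p.73] -/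
def vP : M := fun j => if j * j < 2 then 1 else Multiplicative.ofAdd j
/-- `v⁻ := j · 𝟙_{j² < 2}`. [cite: MochizukiEtTh2009, Def 3.3 p.73] -/
def vN : M := fun j => if j * j < 2 then Multiplicative.ofAdd j else 1

/-- `u := [u⁺]/[u⁻] ∈ Φ₀^gp` (coordinate `+1` at `j² < 2`, `−1` at `j² > 2`). [cite: MochizukiEtTh2009, Def 3.3 p.73] -/
def u : Algebra.GrothendieckGroup M := Algebra.GrothendieckGroup.of uP / Algebra.GrothendieckGroup.of uN
/-- `v := [v⁺]/[v⁻] ∈ Φ₀^gp` (coordinate `−j` at `j² < 2`, `+j` at `j² > 2`). [cite: MochizukiEtTh2009, Def 3.3 p.73] -/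
def v : Algebra.GrothendieckGroup M := Algebra.GrothendieckGroup.of vP / Algebra.GrothendieckGroup.of vN

/-- `B₀ := ℤ × ℤ` (multiplicatively). [cite: MochizukiEtTh2009, Def 3.3 p.73] -/
abbrev B : Type := Multiplicative ℤ × Multiplicative ℤ

/-- `B₀ → Φ₀^gp`, `(a, b) ↦ u^a · v^b`. [cite: MochizukiEtTh2009, Def 3.3 p.73] -/
def divH : B →* Algebra.GrothendieckGroup M := MonoidHom.coprod (zpowersHom _ u) (zpowersHom _ v)

/-- `divH (a, b) = u^a · v^b`. [cite: MochizukiEtTh2009, Def 3.3 p.73] -/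
theorem divH_apply (g : B) : divH g = u ^ Multiplicative.toAdd g.1 * v ^ Multiplicative.toAdd g.2 := by
  rw [divH, MonoidHom.coprod_apply, zpowersHom_apply, zpowersHom_apply]

/-! ### Rational coordinates on `Φ₀^gp` -/

/-- The `j`-th coordinate `M → (ℚ, +)` (written multiplicatively). [cite: MochizukiFrdI2008, Def. 2.4(i) p.47] -/
def evalQ (j : ℚ≥0) : M →* Multiplicative ℚ :=
  (AddMonoidHom.toMultiplicative NNRat.coeHom.toAddMonoidHom).comp (Pi.evalMonoidHom (fun _ : ℚ≥0 => Multiplicative ℚ≥0) j)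

/-- The `j`-th coordinate extended to `Φ₀^gp → ℚ`. [cite: MochizukiFrdI2008, Def. 2.4(i) p.47] -/
def cQ (j : ℚ≥0) : Algebra.GrothendieckGroup M →* Multiplicative ℚ := Algebra.GrothendieckGroup.lift (evalQ j)

/-- The rational coordinate `c_j(g) := toAdd (cQ j g)`. [cite: MochizukiFrdI2008, Def. 2.4(i) p.47] -/
def c (j : ℚ≥0) (g : Algebra.GrothendieckGroup M) : ℚ := Multiplicative.toAdd (cQ j g)

/-- `cQ j [m] = evalQ j m`. [cite: MochizukiFrdI2008, Def. 2.4(i) p.47] -/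
theorem cQ_of (j : ℚ≥0) (m : M) : cQ j (Algebra.GrothendieckGroup.of m) = evalQ j m := by
  have h := Algebra.GrothendieckGroup.lift.symm_apply_apply (evalQ j)
  rw [Algebra.GrothendieckGroup.lift_symm_apply] at h
  exact DFunLike.congr_fun h m

/-- `c_j [m] = m_j`. [cite: MochizukiFrdI2008, Def. 2.4(i) p.47] -/
theorem c_of (j : ℚ≥0) (m : M) : c j (Algebra.GrothendieckGroup.of m) = ((Multiplicative.toAdd (m j) : ℚ≥0) : ℚ) := by
  rw [c, cQ_of]; rfl

/-- `c_j [m] ≥ 0`. [cite: MochizukiFrdI2008, Def. 2.4(i) p.47] -/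
theorem c_of_nonneg (j : ℚ≥0) (m : M) : 0 ≤ c j (Algebra.GrothendieckGroup.of m) := by
  rw [c_of]; exact NNRat.coe_nonneg _

/-- `c_j` is additive. [folklore] -/
private theorem c_mul (j : ℚ≥0) (g g' : Algebra.GrothendieckGroup M) : c j (g * g') = c j g + c j g' := by
  rw [c, map_mul, toAdd_mul, c, c]
/-- `c_j` on quotients. [folklore] -/
private theorem c_div (j : ℚ≥0) (g g' : Algebra.GrothendieckGroup M) : c j (g / g') = c j g - c j g' := by
  rw [c, map_div, toAdd_div, c, c]
/-- `c_j` on powers. [folklore] -/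
private theorem c_zpow (j : ℚ≥0) (g : Algebra.GrothendieckGroup M) (n : ℤ) : c j (g ^ n) = n * c j g := by
  rw [c, map_zpow, toAdd_zpow, c, zsmul_eq_mul]

/-- The coordinate vector of `u`: `U_j = 1` if `j² < 2`, `−1` otherwise. [cite: MochizukiEtTh2009, Def 3.3 p.73] -/
def U (j : ℚ≥0) : ℚ := if j * j < 2 then 1 else -1
/-- The coordinate vector of `v`: `V_j = −j` if `j² < 2`, `j` otherwise. [cite: MochizukiEtTh2009, Def 3.3 p.73] -/
def V (j : ℚ≥0) : ℚ := if j * j < 2 then -(j : ℚ) else j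

/-- `c_j(u) = U_j`. [cite: MochizukiEtTh2009, Def 3.3 p.73] -/
theorem c_u (j : ℚ≥0) : c j u = U j := by
  simp only [u, c_div, c_of, uP, uN, U]
  split_ifs <;> simp

/-- `c_j(v) = V_j`. [cite: MochizukiEtTh2009, Def 3.3 p.73] -/
theorem c_v (j : ℚ≥0) : c j v = V j := by
  simp only [v, c_div, c_of, vP, vN, V]
  split_ifs <;> simp

/-- Coordinates of `divH (a, b) = a·u + b·v`. [cite: MochizukiEtTh2009, Def 3.3 p.73] -/
theorem c_divH (g : B) (j : ℚ≥0) :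
    c j (divH g) = (Multiplicative.toAdd g.1 : ℤ) * U j + (Multiplicative.toAdd g.2 : ℤ) * V j := by
  rw [divH_apply, c_mul, c_zpow, c_zpow, c_u, c_v]

/-! ### The effective cone of `ℝ·u + ℝ·v` is the irrational ray `ℝ_{≥0}·(√2, 1)` -/

/-- `j² < 2` in `ℚ_{≥0}` iff `(j : ℝ) < √2`. [cite: MochizukiEtTh2009, Prop 3.4 (ii) p.74] -/
theorem sq_lt_two_iff (j : ℚ≥0) : j * j < 2 ↔ (j : ℝ) < Real.sqrt 2 := by
  have hj : (0 : ℝ) ≤ ((j : ℚ) : ℝ) := by exact_mod_cast j.coe_nonneg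
  rw [← Rat.cast_nnratCast, Real.lt_sqrt hj, sq]
  constructor
  · intro h
    have h' : (j : ℚ) * (j : ℚ) < 2 := by exact_mod_cast h
    exact_mod_cast h'
  · intro h
    have h' : (j : ℚ) * (j : ℚ) < 2 := by exact_mod_cast h
    exact_mod_cast h'

/-- **The effective real combinations `a·u + b·v` lie on the ray `a = √2·b`, `b ≥ 0`**: the constraints are
`a ≥ j·b` for all rational `0 ≤ j < √2` and `a ≤ j·b` for all rational `j > √2`. [cite: MochizukiEtTh2009, Prop 3.4 (ii) p.74] -/
theorem eq_sqrt_two_mul_of_forall_nonneg (a b : ℝ) (h : ∀ j : ℚ≥0, 0 ≤ a * (U j : ℝ) + b * (V j : ℝ)) :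
    a = Real.sqrt 2 * b ∧ 0 ≤ b := by
  have hlo : ∀ j : ℚ≥0, j * j < 2 → 0 ≤ a - b * (j : ℝ) := by
    intro j hj
    have h1 := h j
    rw [U, V, if_pos hj, if_pos hj, Rat.cast_one, Rat.cast_neg, Rat.cast_nnratCast] at h1
    linarith
  have hhi : ∀ j : ℚ≥0, ¬ j * j < 2 → 0 ≤ -a + b * (j : ℝ) := by
    intro j hj
    have h1 := h j
    rw [U, V, if_neg hj, if_neg hj, Rat.cast_neg, Rat.cast_one, Rat.cast_nnratCast] at h1
    linarith
  have h0 : 0 ≤ a := by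
    have h1 := hlo 0 (by norm_num)
    simpa using h1
  have h2 : 0 ≤ -a + b * 2 := by
    have h1 := hhi 2 (by norm_num)
    push_cast at h1
    exact h1
  have hb : 0 ≤ b := by linarith
  refine ⟨?_, hb⟩
  rcases hb.eq_or_lt with hb0 | hb0
  · rw [← hb0] at h2 ⊢
    rw [mul_zero]
    linarith
  have hs : (0 : ℝ) < Real.sqrt 2 := Real.sqrt_pos.mpr (by norm_num)
  rcases lt_trichotomy (a / b) (Real.sqrt 2) with hlt | heq | hgt
  · -- a rational `j` with `a/b < j < √2` violates `a ≥ j·b`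
    exfalso
    obtain ⟨q, hq1, hq2⟩ := exists_rat_btwn hlt
    have hq0 : (0 : ℚ) ≤ q := by exact_mod_cast ((div_nonneg h0 hb).trans hq1.le)
    have hjq : ((q.toNNRat : ℚ≥0) : ℝ) = (q : ℝ) := by rw [← Rat.cast_nnratCast, Rat.coe_toNNRat q hq0]
    have hj : q.toNNRat * q.toNNRat < 2 := by rw [sq_lt_two_iff, hjq]; exact hq2
    have h1 := hlo _ hj
    rw [hjq] at h1
    have h3 := (div_lt_iff₀ hb0).mp hq1
    linarith
  · rw [div_eq_iff hb0.ne'] at heq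
    exact heq
  · -- a rational `j` with `√2 < j < a/b` violates `a ≤ j·b`
    exfalso
    obtain ⟨q, hq1, hq2⟩ := exists_rat_btwn hgt
    have hq0 : (0 : ℚ) ≤ q := by exact_mod_cast (hs.le.trans hq1.le)
    have hjq : ((q.toNNRat : ℚ≥0) : ℝ) = (q : ℝ) := by rw [← Rat.cast_nnratCast, Rat.coe_toNNRat q hq0]
    have hj : ¬ q.toNNRat * q.toNNRat < 2 := by rw [sq_lt_two_iff, hjq, not_lt]; exact hq1.le
    have h1 := hhi _ hj
    rw [hjq] at h1
    have h3 := (lt_div_iff₀ hb0).mp hq2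
    linarith

/-- **No non-trivial INTEGER combination `a·u + b·v` is effective** (`√2` is irrational).
[cite: MochizukiEtTh2009, Prop 3.4 (ii) p.74] -/
theorem eq_zero_of_forall_nonneg (a b : ℤ) (h : ∀ j : ℚ≥0, 0 ≤ (a : ℝ) * (U j : ℝ) + (b : ℝ) * (V j : ℝ)) :
    a = 0 ∧ b = 0 := by
  obtain ⟨hab, -⟩ := eq_sqrt_two_mul_of_forall_nonneg a b h
  by_cases hb0 : b = 0
  · refine ⟨?_, hb0⟩
    rw [hb0, Int.cast_zero, mul_zero] at hab
    exact_mod_cast hab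
  · exfalso
    have hbR : (b : ℝ) ≠ 0 := by exact_mod_cast hb0
    refine irrational_sqrt_two ⟨(a : ℚ) / (b : ℚ), ?_⟩
    rw [Rat.cast_div, Rat.cast_intCast, Rat.cast_intCast, hab, mul_div_cancel_right₀ _ hbR]

/-- **Effective locus and kernel of `B₀ → Φ₀^gp` are trivial**: if all coordinates of `divH (a, b)` are `≥ 0`
then `(a, b) = 0`. [cite: MochizukiEtTh2009, Prop 3.4 (ii) p.74] -/
theorem eq_one_of_c_divH_nonneg (g : B) (h : ∀ j, 0 ≤ c j (divH g)) : g = 1 := by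
  have h' : ∀ j : ℚ≥0, 0 ≤ ((Multiplicative.toAdd g.1 : ℤ) : ℝ) * (U j : ℝ) +
      ((Multiplicative.toAdd g.2 : ℤ) : ℝ) * (V j : ℝ) := by
    intro j
    have := h j
    rw [c_divH] at this
    exact_mod_cast this
  obtain ⟨h1, h2⟩ := eq_zero_of_forall_nonneg _ _ h'
  exact Prod.ext (Multiplicative.toAdd.injective h1) (Multiplicative.toAdd.injective h2)


end Sec3Prop34CnstOfRlfRSupportNegative

end Literature.AnabelianGeometry.EtaleTheta

end
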